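import Literature.Probability.Percolation.KozmaNitzanBoxes
import Literature.Probability.Percolation.SubgraphMonotonicity
import Literature.Probability.Percolation.SitePaths
import Literature.Probability.LatticeModels.IsingThermodynamicsProofs
import Mathlib.Combinatorics.SimpleGraph.Prod
import HarnessLib

/-!
# Φ1-prod, part A: product boxes `B × Λ` in `X □ ℤ²` — boundaries, the two kinds of contact, product paths, slice windows/seeds,
# counting (BLUEPRINT-I-PHI §6 Target 1; generalises the graph-dependent layer of `L/KozmaNitzanBoxes.lean` from `ℤ^d` to `X □ zdGraph 2`)

builds on p205010 (kernel theorem, internal audit signed; external expert review pending) — nothing in this file uses p205010.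
Lane `prim-bschramm`, BLUEPRINT-I-PHI.md §3 file Φ1 / §6 ("re-type the PRODUCT form FIRST: G = X □ zdGraph 2, cells B_X × square, NO shear,
D₄ = id × HOct 2"); seat `prim-bschramm-p2` (lead ack 06:22Z); helper file (`--supports stmt-CriticalPhenomena-4575`).  No definitions, no
named facts, no sorries: the fibre part of a box is an ARBITRARY finite set `B ⊆ W` (a fibre ball `B_X(c, R)` in the blueprint), boxes are
written `B ×ˢ Finset.Icc lo hi`, slices `t ↦ (w, t)` inline, and Kozma–Nitzan's planar window objects (`WinHyp`, `plaq`, `wreg`, `cube`,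
`uface`, `seedEdges` of `L/KozmaNitzanBoxes.lean` at `d = 2`) are used AS THEY ARE inside a slice `{w} × ℤ²` (macro directions only —
BLUEPRINT §1: "faces / orthant-faces ONLY macro", "seeds = planar plaquettes in the φ-directions at the contact").

* §1 slices and product paths: `Transplant.ProdKN.pathIn_map` (paths are pushed along adjacency-preserving maps — the tree had only
  `PathIn.mono_graph`), `pathIn_slice`, `pathIn_fibre`, `exists_pathIn_prodBox` (staircase in `ℤ²` after a path in `B`);
* §2 boundaries of `B × Λ`: `outerBoundary_prodBox_cases` — a vertex of the outer boundary is EITHER a MACRO contact (`x.1 ∈ B`, `x.2` in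
  the planar outer boundary of `Λ`, joined to `(x.1, y₂)`, `y₂` on a face of `Λ`: Kozma–Nitzan's `exists_dir_of_mem_outerBoundary` at `d = 2`
  applies verbatim to `x.2`) OR a FIBRE contact (`x.2 ∈ Λ`, `x.1` in the outer boundary of `B` in `X`); `mem_innerBoundary_prodBox_iff`;
  `outerBoundary_prodBox_subset`; `exists_winHyp_of_macroContact` (the planar window at a macro contact, verbatim shape `x.2 = y₂ + σ e_i`);
* §3 slice seeds are edges of `G` and join the contact to the window's face: `seedEdges_slice_subset_edgeSet`,
  `openConn_slice_of_seedEdges_subset` (pull back the configuration to the slice by `restrictConfig`, apply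
  `KozmaNitzan.openConn_of_seedEdges_subset` in `ℤ²`, push the open path forward by `reachable_map_of_restrictConfig`);
* §4 counting: `degree_prod_le` (`deg ≤ Δ_X + 4`), `card_edgesIn_prod_le` (`|E(Λ)| ≤ (Δ_X + 4)|Λ|`, replacing `2d|Λ|`).
What is NOT here (Φ0 / later Φ1 parts): `PRISM` with windows, `IsSubbox_Φ`, the enlarged boxes `B⟨j⟩` growing in the fibre (amendment (B)),
`Ncont/seedBound` bookkeeping over prisms.

[cite: KozmaNitzan2024, §4 pp. 15–21 (boxes, ∂_iv, ∂_ev, plaquettes, seeds — the ℤ^d model)] [cite: GrimmettPercolation1999, §7.2]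
-/

noncomputable section

namespace Summit.CriticalPhenomena.PercolationContinuityZ3.Theorems

namespace Transplant

namespace ProdKN

open Literature.Probability.Percolation Literature.Probability.LatticeModels
open Literature.Probability.Percolation.KozmaNitzan

variable {W : Type*} (X : SimpleGraph W)

/-! ## §1 Paths along adjacency-preserving maps; slices and fibres of `X □ ℤ²` -/

/-- Paths inside a set are pushed forward along any adjacency-preserving map into a set containing the image. [folklore] -/
theorem pathIn_map {V V' : Type*} {G : SimpleGraph V} {G' : SimpleGraph V'} (f : V → V') (hf : ∀ a b, G.Adj a b → G'.Adj (f a) (f b))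
    {A : Set V} {A' : Set V'} (hA : ∀ a ∈ A, f a ∈ A') {u v : V} (h : PathIn G A u v) : PathIn G' A' (f u) (f v) := by
  obtain ⟨hu, h⟩ := h
  refine ⟨hA u hu, ?_⟩
  induction h with
  | refl => exact Relation.ReflTransGen.refl
  | tail _ hbc ih => exact ih.tail ⟨hf _ _ hbc.1, hA _ hbc.2⟩

/-- The slice `t ↦ (w, t)` is adjacency-preserving `ℤ² → X □ ℤ²`. [folklore] -/
theorem adj_slice (w : W) {t t' : Site 2} (h : (zdGraph 2).Adj t t') : (X □ zdGraph 2).Adj (w, t) (w, t') :=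
  SimpleGraph.boxProd_adj_right.2 h

/-- The fibre `w ↦ (w, t)` is adjacency-preserving `X → X □ ℤ²`. [folklore] -/
theorem adj_fibre (t : Site 2) {w w' : W} (h : X.Adj w w') : (X □ zdGraph 2).Adj (w, t) (w', t) :=
  SimpleGraph.boxProd_adj_left.2 h

/-- A planar path inside `Λ` lifts to the slice `{w} × Λ ⊆ B × Λ` (`w ∈ B`). [folklore] -/
theorem pathIn_slice {B : Finset W} {Λ : Finset (Site 2)} {w : W} (hw : w ∈ B) {t t' : Site 2}
    (h : PathIn (zdGraph 2) (↑Λ : Set (Site 2)) t t') :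
    PathIn (X □ zdGraph 2) (↑(B ×ˢ Λ) : Set (W × Site 2)) (w, t) (w, t') :=
  pathIn_map (fun s : Site 2 => (w, s)) (fun _ _ hab => adj_slice X w hab)
    (fun a ha => by rw [Finset.coe_product]; exact Set.mk_mem_prod (Finset.mem_coe.2 hw) ha) h

/-- A path in `B` lifts to the fibre `B × {t} ⊆ B × Λ` (`t ∈ Λ`). [folklore] -/
theorem pathIn_fibre {B : Finset W} {Λ : Finset (Site 2)} {t : Site 2} (ht : t ∈ Λ) {w w' : W}
    (h : PathIn X (↑B : Set W) w w') : PathIn (X □ zdGraph 2) (↑(B ×ˢ Λ) : Set (W × Site 2)) (w, t) (w', t) :=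
  pathIn_map (fun u : W => (u, t)) (fun _ _ hab => adj_fibre X t hab)
    (fun a ha => by rw [Finset.coe_product]; exact Set.mk_mem_prod ha (Finset.mem_coe.2 ht)) h

/-- **Two vertices of a product box `B × Λ` (`Λ = Icc lo hi`, `B` connected inside itself) are joined by a path inside the box**: a path in
the fibre followed by the planar staircase (`KozmaNitzan.exists_pathIn_Icc` at `d = 2`). [folklore] -/
theorem exists_pathIn_prodBox {B : Finset W} (hB : ∀ w ∈ B, ∀ w' ∈ B, PathIn X (↑B : Set W) w w') {lo hi : Site 2}
    {x y : W × Site 2} (hx : x ∈ B ×ˢ Finset.Icc lo hi) (hy : y ∈ B ×ˢ Finset.Icc lo hi) :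
    PathIn (X □ zdGraph 2) (↑(B ×ˢ Finset.Icc lo hi) : Set (W × Site 2)) x y := by
  rw [Finset.mem_product] at hx hy
  exact (pathIn_fibre X hx.2 (hB _ hx.1 _ hy.1)).trans (pathIn_slice X hy.1 (KozmaNitzan.exists_pathIn_Icc hx.2 hy.2))

/-! ## §2 Boundaries of a product box and the two kinds of contact -/

variable [DecidableEq W] [X.LocallyFinite]

/-- **Dichotomy for the outer boundary of `B × Λ` in `X □ ℤ²`**: a vertex outside the box with a neighbour inside is either a MACRO contact
(`x.1 ∈ B`, and `x.2` lies in the planar outer boundary of `Λ`) or a FIBRE contact (`x.2 ∈ Λ`, and `x.1` lies in the outer boundary of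
`B` in `X`).  (For `ℤ^d` there is only the first kind; KN p. 18.) [cite: KozmaNitzan2024, §4 p. 18] -/
theorem outerBoundary_prodBox_cases {B : Finset W} {Λ : Finset (Site 2)} {x : W × Site 2}
    (hx : x ∈ outerBoundary (X □ zdGraph 2) (B ×ˢ Λ)) :
    (x.1 ∈ B ∧ x.2 ∈ outerBoundary (zdGraph 2) Λ) ∨ (x.2 ∈ Λ ∧ x.1 ∈ outerBoundary X B) := by
  rw [mem_outerBoundary_iff] at hx
  obtain ⟨hxB, y, hy, hxy⟩ := hx
  rw [Finset.mem_product] at hy hxB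
  rcases SimpleGraph.boxProd_adj.1 hxy with ⟨h1, h2⟩ | ⟨h1, h2⟩
  · -- an `X`-edge at height `x.2 = y.2 ∈ Λ`
    right
    refine ⟨h2 ▸ hy.2, ?_⟩
    rw [mem_outerBoundary_iff]
    exact ⟨fun h => hxB ⟨h, h2 ▸ hy.2⟩, y.1, hy.1, h1⟩
  · -- a planar edge in the slice `x.1 = y.1 ∈ B`
    left
    refine ⟨h2 ▸ hy.1, ?_⟩
    rw [mem_outerBoundary_iff]
    exact ⟨fun h => hxB ⟨h2 ▸ hy.1, h⟩, y.2, hy.2, h1⟩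

/-- The outer boundary of `B × Λ` lies in `(B × ∂^{out}Λ) ∪ (∂^{out}_X B × Λ)`. [folklore] -/
theorem outerBoundary_prodBox_subset {B : Finset W} {Λ : Finset (Site 2)} :
    outerBoundary (X □ zdGraph 2) (B ×ˢ Λ) ⊆ B ×ˢ outerBoundary (zdGraph 2) Λ ∪ outerBoundary X B ×ˢ Λ := by
  intro x hx
  rw [Finset.mem_union, Finset.mem_product, Finset.mem_product]
  rcases outerBoundary_prodBox_cases X hx with h | h
  · exact Or.inl h
  · exact Or.inr ⟨h.2, h.1⟩

/-- **Inner boundary of `B × Icc lo hi`**: a vertex of the box has a neighbour outside iff its fibre coordinate is an inner-boundary vertex of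
`B` in `X` or its planar coordinate is extreme (`KozmaNitzan.mem_innerBoundary_Icc` at `d = 2`). [cite: KozmaNitzan2024, §4 p. 15 (∂_iv)] -/
theorem mem_innerBoundary_prodBox_iff {B : Finset W} {lo hi : Site 2} {x : W × Site 2} :
    x ∈ innerBoundary (X □ zdGraph 2) (B ×ˢ Finset.Icc lo hi) ↔
      x ∈ B ×ˢ Finset.Icc lo hi ∧ (x.1 ∈ innerBoundary X B ∨ ∃ i, x.2 i = lo i ∨ x.2 i = hi i) := by
  rw [mem_innerBoundary_iff]
  refine and_congr_right fun hxB => ?_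
  rw [Finset.mem_product] at hxB
  constructor
  · rintro ⟨y, hy, hxy⟩
    rw [Finset.mem_product, not_and_or] at hy
    rcases SimpleGraph.boxProd_adj.1 hxy with ⟨h1, h2⟩ | ⟨h1, h2⟩
    · rcases hy with hy | hy
      · left; rw [mem_innerBoundary_iff]; exact ⟨hxB.1, y.1, hy, h1⟩
      · exact absurd (h2 ▸ hxB.2) hy
    · rcases hy with hy | hy
      · exact absurd (h2 ▸ hxB.1) hy
      · right
        exact ((KozmaNitzan.mem_innerBoundary_Icc (d := 2)).1 (mem_innerBoundary_iff.2 ⟨hxB.2, y.2, hy, h1⟩)).2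
  · rintro (h | h)
    · rw [mem_innerBoundary_iff] at h
      obtain ⟨-, w, hw, hxw⟩ := h
      refine ⟨(w, x.2), ?_, SimpleGraph.boxProd_adj_left.2 hxw⟩
      rw [Finset.mem_product, not_and_or]; exact Or.inl hw
    · obtain ⟨-, t, ht, hxt⟩ := mem_innerBoundary_iff.1 ((KozmaNitzan.mem_innerBoundary_Icc (d := 2)).2 ⟨hxB.2, h⟩)
      refine ⟨(x.1, t), ?_, SimpleGraph.boxProd_adj_right.2 hxt⟩
      rw [Finset.mem_product, not_and_or]; exact Or.inr ht

/-- **The planar window at a MACRO contact** (BLUEPRINT §1: windows/plaquettes live in the macro directions of the slice): for a macro contact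
`x` of `B × Icc Lo Hi` (all planar sides `> 2M+2`) there are `(i, σ, y₂)` with Kozma–Nitzan's `WinHyp Lo Hi M i σ y₂` in `ℤ²` and
`x.2 = y₂ + σ e_i`; the inner neighbour of `x` is `(x.1, y₂)` in the same slice. Verbatim `KozmaNitzan.exists_winHyp_of_mem_outerBoundary` at
`d = 2`. [cite: KozmaNitzan2024, §4 pp. 19–21] -/
theorem exists_winHyp_of_macroContact {B : Finset W} {Lo Hi : Site 2} {M : ℕ} (hwide : ∀ k, Lo k + 2 * M + 2 ≤ Hi k) {x : W × Site 2}
    (hx : x ∈ outerBoundary (X □ zdGraph 2) (B ×ˢ Finset.Icc Lo Hi)) (hmacro : x.1 ∈ B) :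
    ∃ (i : Fin 2) (σ : ℤ) (y₂ : Site 2), WinHyp Lo Hi M i σ y₂ ∧ x.2 = y₂ + σ • unitVec i ∧
      (X □ zdGraph 2).Adj (x.1, y₂) x ∧ (x.1, y₂) ∈ B ×ˢ Finset.Icc Lo Hi := by
  have h2 : x.2 ∈ outerBoundary (zdGraph 2) (Finset.Icc Lo Hi) := by
    rcases outerBoundary_prodBox_cases X hx with h | h
    · exact h.2
    · exfalso
      exact (mem_outerBoundary_iff.1 h.2).1 hmacro
  obtain ⟨i, σ, y₂, hW, hxy⟩ := KozmaNitzan.exists_winHyp_of_mem_outerBoundary hwide h2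
  refine ⟨i, σ, y₂, hW, hxy, ?_, ?_⟩
  · have hadj : (zdGraph 2).Adj y₂ x.2 := by
      rw [hxy]; exact adj_iff_exists_sign.2 ⟨i, σ, hW.sign, rfl⟩
    have := adj_slice X x.1 hadj
    rwa [Prod.mk.eta] at this
  · rw [Finset.mem_product]
    exact ⟨hmacro, KozmaNitzan.mem_Icc_iff.2 hW.mem⟩

/-! ## §3 Slice seeds: edges of `X □ ℤ²`, and the open connection they force -/

omit [X.LocallyFinite] in
/-- **Planar seed edges, placed in the slice `{w} × ℤ²`, are edges of `X □ ℤ²`.** [cite: KozmaNitzan2024, §4 p. 19 (seeds)] -/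
theorem seedEdges_slice_subset_edgeSet {Lo Hi : Site 2} {M : ℕ} {i : Fin 2} {σ : ℤ} {y₂ : Site 2} (h : WinHyp Lo Hi M i σ y₂) (w : W) :
    ∀ e ∈ (seedEdges Lo Hi M i σ y₂).image (Sym2.map fun t : Site 2 => (w, t)), e ∈ (X □ zdGraph 2).edgeSet := by
  intro e he
  obtain ⟨e₀, he₀, rfl⟩ := Finset.mem_image.1 he
  have h0 : e₀ ∈ (zdGraph 2).edgeSet := KozmaNitzan.seedEdges_subset_edgeSet h (Finset.mem_coe.2 he₀)
  induction e₀ using Sym2.ind with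
  | h a b => rw [Sym2.map_mk, SimpleGraph.mem_edgeSet]; exact adj_slice X w ((SimpleGraph.mem_edgeSet (G := zdGraph 2)).1 h0)

omit [X.LocallyFinite] in
/-- **A slice seed joins the macro contact to every vertex of the window's face, inside the slice**: if all images in `{w} × ℤ²` of the
planar seed edges of `y₂` are open in `ω`, then `(w, y₂ + σ e_i) ↔ (w, u)` in `ω` for every `u ∈ U(P)` — `KozmaNitzan.openConn_of_seedEdges_subset`
applied to the pulled-back planar configuration `restrictConfig (t ↦ (w,t)) ω`, pushed forward by `reachable_map_of_restrictConfig`.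
[cite: KozmaNitzan2024, §4 p. 21] -/
theorem openConn_slice_of_seedEdges_subset {Lo Hi : Site 2} {M : ℕ} {i : Fin 2} {σ : ℤ} {y₂ : Site 2} (h : WinHyp Lo Hi M i σ y₂) (w : W)
    {ω : BondConfig (W × Site 2)} (hω : ∀ e ∈ (seedEdges Lo Hi M i σ y₂).image (Sym2.map fun t : Site 2 => (w, t)), e ∈ ω)
    {u : Site 2} (hu : u ∈ uface Lo Hi M i σ y₂) : ω ∈ openConn (w, y₂ + σ • unitVec i) (w, u) := by
  have hsub : (↑(seedEdges Lo Hi M i σ y₂) : Set (Sym2 (Site 2))) ⊆ restrictConfig (fun t : Site 2 => (w, t)) ω := by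
    intro e he
    rw [mem_restrictConfig]
    exact hω _ (Finset.mem_image.2 ⟨e, Finset.mem_coe.1 he, rfl⟩)
  have hplanar := KozmaNitzan.openConn_of_seedEdges_subset h hsub hu
  exact reachable_map_of_restrictConfig (fun a b hab => (Prod.mk.inj hab).2) ω hplanar

/-! ## §4 Counting -/

omit [DecidableEq W] in
/-- Degrees in `X □ ℤ²`: `deg (w,t) = deg_X w + 4 ≤ Δ + 4` under a degree bound `Δ` on `X`. [folklore] -/
theorem degree_prod_le {Δ : ℕ} (hΔ : ∀ w, X.degree w ≤ Δ) (x : W × Site 2) : (X □ zdGraph 2).degree x ≤ Δ + 4 := by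
  classical
  rw [SimpleGraph.degree_boxProd]
  have h2 : (zdGraph 2).degree x.2 ≤ 2 * 2 := by
    rw [← SimpleGraph.card_incidenceFinset_eq_degree]; exact card_incidenceFinset_zdGraph_le x.2
  have := hΔ x.1
  omega

/-- **`|E(Λ)| ≤ (Δ_X + 4)·|Λ|` in `X □ ℤ²`** (replaces `KozmaNitzan.card_edgesIn_le`'s `2d·|Λ|`; finite energy on the edges of a region and the
envelope bound of Theorem A count through this). [folklore] -/
theorem card_edgesIn_prod_le {Δ : ℕ} (hΔ : ∀ w, X.degree w ≤ Δ) (Λ : Finset (W × Site 2)) :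
    (edgesIn (X □ zdGraph 2) Λ).card ≤ (Δ + 4) * Λ.card := by
  classical
  calc (edgesIn (X □ zdGraph 2) Λ).card ≤ (edgesTouching (X □ zdGraph 2) Λ).card := Finset.card_le_card (edgesIn_subset_edgesTouching Λ)
    _ ≤ ∑ x ∈ Λ, ((X □ zdGraph 2).incidenceFinset x).card := Finset.card_biUnion_le
    _ ≤ ∑ _x ∈ Λ, (Δ + 4) := Finset.sum_le_sum fun x _ => by
        rw [SimpleGraph.card_incidenceFinset_eq_degree]; exact degree_prod_le X hΔ x
    _ = (Δ + 4) * Λ.card := by rw [Finset.sum_const, smul_eq_mul, mul_comm]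

end ProdKN

end Transplant

end Summit.CriticalPhenomena.PercolationContinuityZ3.Theorems

end
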